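import Literature.AlgebraicGeometry.Motives.HodgeThetaSubalgebraRankThree
import Literature.AlgebraicGeometry.HodgeTheory.AbelianVarietySlotsWordModel
import HarnessLib

/-!
# `𝔰𝔩₂`-isotypic letters: block matrices of pair-indexed operators in the word model, and the pair basis
# `(u_τ, F u_τ)` of a weight-one Hodge structure of Hodge-group rank three (Murty 1984 / Moonen–Zarhin 1999 §2, bookkeeping)

Family `hodge`, layer `Literature/AlgebraicGeometry/HodgeTheory`.  Written for the cell `pub-hodgecm2` (COR-CM), seat `b27`,
count-neutral lane MT-RANK-FOUR-DIVISORS — the cycle side of the Mumford–Tate rank ladder rung `dim MT(H¹X) = 4`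
(`Summits/HodgeConjecture/CorCM/MumfordTateRankFour`): UNCONDITIONAL Hodge theory of complex abelian varieties, a
formalisation of a published theorem (Murty 1984, via Gordon's survey Thm. 7.5 / §7.3.2), no step towards a summit
statement and no use of HC_CM.  Everything is proved; no definition, no named fact (D-0026); axioms standard.

SETTING (all files of the lane).  `X` a complex abelian variety whose weight-one `ℚ`-Hodge structure
`H = H¹(X(ℂ); ℚ)` (`BettiUniverse.hodge`) has `dim_ℚ Lie Hg(H) ≤ 3` and `Lie Hg(H) ⊄ End_Hdg(H)` — equivalently `X` is NOT
of CM type and `dim MT(H¹X) ≤ 4` (Moonen–Zarhin 1999 §2: Type I(1) `Hg = SL₂`, e.g. a non-CM elliptic curve, and Type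
II(1) `Hg = SL₁(D)`, e.g. an abelian surface with quaternionic multiplication; and all their powers).  In a graded
basis `e` of `H ⊗ ℂ` with grading projector `P` onto `H^{1,0}` and some `X₀ ∈ Lie Hg ∖ End_Hdg`:
`Lie Hg ⊗ ℂ = ℂΘ′ ⊕ ℂE ⊕ ℂF ≅ 𝔰𝔩₂`, `Θ′ = 2P − 1`, `E = P X₀,ℂ (1 − P)`, `F = (1 − P) X₀,ℂ P`, `E F = α P`, `α ≠ 0`
(`Motives/HodgeLieWeightOneSl2Triple`); the PAIR BASIS `u_τ = e τ` (`deg τ = 1`), `w_τ = F u_τ` exhibits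
`H ⊗ ℂ ≅ H^{1,0} ⊗ std`.  `B` is an abelian variety with a slot structure `g : Fin n → (B ⟶ X)` (`AVSlots`, e.g.
`B = X^{N+1}`); its LETTERS are the classes `g_s^* u_τ, g_s^* w_τ ∈ H¹(B(ℂ); ℂ)` indexed by `((s, τ), kind)`.

THIS FILE (bookkeeping, no geometry beyond the word model):
* §1 `wordDer_blockMatrix_wordSlice_apply`, `forall_wordDer_blockMatrix_eq_zero_iff` — a block matrix
  `[place = place] · N₀` (alphabet `Fin N ≃ T × Fin 2`), placed at all positions, kills the slices of a coefficient
  function along slot words iff the `2 × 2` block `N₀` kills the slices of the REFINED coefficient function (letters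
  `(J × T) × Fin 2`) along slot-and-place words; `wordEval_kindRefine` (the evaluation is unchanged by the refinement);
  `toMatrix_reindex_eq_blockMatrix` (the matrix of a pair-indexed block operator in the reindexed basis).
* §2 `HodgeStructure.exists_pairBasis` — the pair basis `b (τ, 0) = e τ`, `b (τ, 1) = F (e τ)` of `H ⊗ ℂ`
  (independence by applying `P` and `E`, generation by `v = P v + α⁻¹ F (E v)`); `HodgeStructure.pairBasis_actions` —
  `E`, `F`, `Θ′` act on it by the blocks `α E₀₁`, `E₁₀`, `diag(1, −1)`.

## References

* [Gordon1997] B. B. Gordon, *A survey of the Hodge conjecture for abelian varieties*, App. B of Lewis, CRM Monogr.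
  Ser. 10 (1999) = arXiv:alg-geom/9709030 (held `paper:arxiv-alg-geom_9709030`): §3, §7.3.2 (Murty: type (H); non-CM
  elliptic curves and QM abelian surfaces), Thm. 7.5 (Murty 1984 [B.82] / Hazama 1984 [B.47]), Def. 7.6.
* [MoonenZarhin1999LowDim] B. Moonen, Yu. Zarhin, *Hodge classes on abelian varieties of low dimension*, Math. Ann.
  315 (1999) 711–733, §2 (2.1)–(2.2).
* [GoodmanWallachGTM255] R. Goodman, N. R. Wallach, GTM 255 (2009), §4.1.1, Thm. 5.3.3.
* [FultonYoungTableaux1997] W. Fulton, *Young Tableaux* (1997), §7.2, §8.1.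
* [FultonHarris1991] W. Fulton, J. Harris, *Representation Theory*, GTM 129 (1991), Lecture 11 (§11.1).
-/

noncomputable section

open scoped TensorProduct

namespace Literature.AlgebraicGeometry.HodgeTheory

open Literature.AlgebraicTopology.SingularHomology
open Literature.AlgebraicGeometry.Motives
open Literature.AlgebraicGeometry.Motives.HodgeStructure
open Literature.Barriers.HodgeConjecture
open Literature.RepresentationTheory.GeneralLinear
open Literature.NumberTheory.DiophantineGeometry

/-! ### §1 Word-model glue: block matrices of pair-indexed operators, refinement of letters `Fin N ≃ T × Fin 2` -/

section WordModel

variable {K : Type*} [Field K] {J T : Type*} {N d : ℕ}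

/-- **A block matrix, placed at all positions, acts on a slice along a slot word as the block acts on the
refined slice**: if `M_{i m} = [place(i) = place(m)] · N₀_{kind(i) kind(m)}` for an identification
`φ : Fin N ≃ T × Fin 2` of the alphabet with (place, kind), then for every coefficient function `a` on words in
the letters `J × Fin N`, every slot word `u` and every colour word `ε`,
`(D(M) a(u, −))(ε) = (D(N₀) a′((u, place ∘ ε), −))(kind ∘ ε)`, where `a′` is `a` re-indexed to the letters
`(J × T) × Fin 2`.  [cite: GoodmanWallachGTM255, §4.1.1] [cite: FultonYoungTableaux1997, §8.1] -/
theorem wordDer_blockMatrix_wordSlice_apply [Fintype T] [DecidableEq T] (φ : Fin N ≃ T × Fin 2)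
    (N₀ : Matrix (Fin 2) (Fin 2) K) {M : Matrix (Fin N) (Fin N) K}
    (hM : ∀ i m, M i m = if (φ i).1 = (φ m).1 then N₀ (φ i).2 (φ m).2 else 0)
    (a : (Fin d → J × Fin N) → K) (u : Fin d → J) (ε : Word N d) :
    wordDer K M (wordSlice a u) ε =
      wordDer K N₀ (wordSlice (fun w : Fin d → (J × T) × Fin 2 =>
          a fun t => ((w t).1.1, φ.symm ((w t).1.2, (w t).2))) fun t => (u t, (φ (ε t)).1))
        fun t => (φ (ε t)).2 := by
  rw [wordDer_apply, wordDer_apply]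
  refine Finset.sum_congr rfl fun t _ => ?_
  rw [← φ.symm.sum_comp, Fintype.sum_prod_type, Finset.sum_eq_single (φ (ε t)).1]
  · refine Finset.sum_congr rfl fun r _ => ?_
    rw [hM, Equiv.apply_symm_apply, if_pos rfl]
    congr 1
    rw [wordSlice_apply, wordSlice_apply]
    congr 1
    funext s
    by_cases hs : s = t
    · subst hs
      simp only [Function.update_self]
    · simp only [Function.update_of_ne hs, Prod.mk.eta, Equiv.symm_apply_apply]
  · intro τ' _ hτ'
    refine Finset.sum_eq_zero fun r _ => ?_
    rw [hM, Equiv.apply_symm_apply, if_neg (Ne.symm hτ'), zero_mul]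
  · intro h
    exact absurd (Finset.mem_univ _) h

/-- **Corollary (both directions): `D(M)` kills all slices of `a` along slot words iff `D(N₀)` kills all slices
of the refined coefficient function along slot-and-place words.** [cite: GoodmanWallachGTM255, §4.1.1] -/
theorem forall_wordDer_blockMatrix_eq_zero_iff [Fintype T] [DecidableEq T] (φ : Fin N ≃ T × Fin 2)
    (N₀ : Matrix (Fin 2) (Fin 2) K) {M : Matrix (Fin N) (Fin N) K}
    (hM : ∀ i m, M i m = if (φ i).1 = (φ m).1 then N₀ (φ i).2 (φ m).2 else 0)
    (a : (Fin d → J × Fin N) → K) :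
    (∀ u : Fin d → J, wordDer K M (wordSlice a u) = 0) ↔
      ∀ U : Fin d → J × T, wordDer K N₀ (wordSlice (fun w : Fin d → (J × T) × Fin 2 =>
        a fun t => ((w t).1.1, φ.symm ((w t).1.2, (w t).2))) U) = 0 := by
  constructor
  · intro h U
    funext η
    set ε : Word N d := fun t => φ.symm ((U t).2, η t) with hε
    have h1 := congrFun (h fun t => (U t).1) ε
    rw [wordDer_blockMatrix_wordSlice_apply φ N₀ hM] at h1
    have hU : (fun t => ((U t).1, (φ (ε t)).1)) = U := funext fun t => by
      rw [hε, Equiv.apply_symm_apply]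
    have hη : (fun t => (φ (ε t)).2) = η := funext fun t => by rw [hε, Equiv.apply_symm_apply]
    rw [hU, hη] at h1
    rw [h1, Pi.zero_apply, Pi.zero_apply]
  · intro h u
    funext ε
    rw [wordDer_blockMatrix_wordSlice_apply φ N₀ hM, h, Pi.zero_apply, Pi.zero_apply]

/-- **The evaluation is unchanged by the refinement of the letters** (a bijection of the letters
`(J × T) × Fin 2 ≃ J × Fin N`). [cite: FultonYoungTableaux1997, §8.1] -/
theorem wordEval_kindRefine [Fintype J] [Fintype T] {H M : Type*} [AddCommGroup H] [Module K H]
    [AddCommGroup M] [Module K M] (F : H [⋀^Fin d]→ₗ[K] M) (φ : Fin N ≃ T × Fin 2)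
    (x : J × Fin N → H) (a : (Fin d → J × Fin N) → K) :
    wordEval F (fun jr : (J × T) × Fin 2 => x (jr.1.1, φ.symm (jr.1.2, jr.2)))
        (fun w : Fin d → (J × T) × Fin 2 => a fun t => ((w t).1.1, φ.symm ((w t).1.2, (w t).2))) =
      wordEval F x a := by
  let θ : (J × T) × Fin 2 ≃ J × Fin N :=
    { toFun := fun jr => (jr.1.1, φ.symm (jr.1.2, jr.2))
      invFun := fun jm => ((jm.1, (φ jm.2).1), (φ jm.2).2)
      left_inv := fun jr => by simp
      right_inv := fun jm => by simp }
  rw [wordEval_apply, wordEval_apply]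
  exact Fintype.sum_equiv (Equiv.arrowCongr (Equiv.refl (Fin d)) θ) _ _ fun w => rfl

/-- **The matrix of a pair-indexed block operator in the reindexed basis is the block matrix**: if
`Y (b (τ, r)) = ∑_{r'} N₀_{r' r} b (τ, r')` for a basis `b` indexed by `T × Fin 2`, then in the basis
`b.reindex φ.symm` indexed by `Fin N` the matrix of `Y` is `[place = place] · N₀`. [cite: GoodmanWallachGTM255, §4.1.1] -/
theorem toMatrix_reindex_eq_blockMatrix [Fintype T] [DecidableEq T] {W : Type*} [AddCommGroup W] [Module K W]
    (b : Module.Basis (T × Fin 2) K W) (φ : Fin N ≃ T × Fin 2) (N₀ : Matrix (Fin 2) (Fin 2) K)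
    {Y : Module.End K W} (hY : ∀ τ r, Y (b (τ, r)) = ∑ r', N₀ r' r • b (τ, r')) (i m : Fin N) :
    LinearMap.toMatrix (b.reindex φ.symm) (b.reindex φ.symm) Y i m =
      if (φ i).1 = (φ m).1 then N₀ (φ i).2 (φ m).2 else 0 := by
  rw [LinearMap.toMatrix_apply, Module.Basis.reindex_apply, Equiv.symm_symm,
    show b (φ m) = b ((φ m).1, (φ m).2) from rfl, hY, map_sum, Finsupp.coe_finsetSum, Finset.sum_apply]
  simp only [map_smul, Module.Basis.repr_reindex_apply, Equiv.symm_symm, Module.Basis.repr_self,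
    Finsupp.smul_apply, Finsupp.single_apply, smul_eq_mul, mul_ite, mul_one, mul_zero]
  by_cases h : (φ i).1 = (φ m).1
  · rw [if_pos h, Finset.sum_eq_single (φ i).2]
    · rw [if_pos]; rw [← h]
    · intro r _ hr
      rw [if_neg]
      intro hri
      apply hr
      exact congrArg Prod.snd hri
    · intro hh; exact absurd (Finset.mem_univ _) hh
  · rw [if_neg h]
    refine Finset.sum_eq_zero fun r _ => ?_
    rw [if_neg]
    intro hri
    exact h (congrArg Prod.fst hri).symm

end WordModel

/-! ### §2 The `𝔰𝔩₂`-adapted pair basis `(u_τ, F u_τ)` of `V_ℂ` -/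

section PairBasis

universe u

variable {V : Type u} [AddCommGroup V] [Module ℚ V] [Module.Finite ℚ V] [HodgeTensorFacts.{u, u}] {n : ℤ}
  {S : Type u} [Fintype S] [DecidableEq S] {deg : S → ℤ}

/-- **The pair basis.**  For an effective polarizable weight-one `H` with `dim Lie Hg ≤ 3` and `X ∈ Lie Hg ∖ End_Hdg`
(graded basis `e`, `P` the grading projector, `E = P X_ℂ (1 − P)`, `F = (1 − P) X_ℂ P`, `E F = α P`, `α ≠ 0`), the
vectors `u_τ = e τ` (`deg τ = 1`, a basis of `V^{1,0}`) together with `w_τ = F u_τ ∈ V^{0,1}` form a basis of `V_ℂ`: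
`V_ℂ ≅ V^{1,0} ⊗ std` as a module over the triple (Moonen–Zarhin Type I(1)/II(1); Fulton–Harris Lecture 11).
Independence: apply `P` (kills the `w`'s) and `E` (`E w_τ = α u_τ`); generation: `v = P v + α⁻¹ F (E v)`.
[cite: MoonenZarhin1999LowDim, §2] [cite: FultonHarris1991, Lecture 11 (§11.1)] -/
theorem HodgeStructure.exists_pairBasis (H : HodgeStructure V n) (ψ : H.Polarization) (hn : n = 1)
    (hH : H.IsEffective) (e : Module.Basis S ℂ (ℂ ⊗[ℚ] V))
    (hF : ∀ a, H.F a = Submodule.span ℂ (e '' {σ | a ≤ deg σ}))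
    (hFc : ∀ a, complexConj (H.F a) = Submodule.span ℂ (e '' {σ | deg σ ≤ n - a}))
    {X : Module.End ℚ V} (hX : X ∈ H.hodgeLie) (hXE : X ∉ H.endAlg) (h3 : Module.finrank ℚ H.hodgeLie ≤ 3) :
    ∃ b : Module.Basis ({σ : S // deg σ = 1} × Fin 2) ℂ (ℂ ⊗[ℚ] V),
      (∀ τ, b (τ, 0) = e τ) ∧
      ∀ τ, b (τ, 1) = ((1 - gradingEnd e deg) * X.baseChange ℂ * gradingEnd e deg) (e τ) := by
  classical
  have hdeg : ∀ σ, deg σ = 0 ∨ deg σ = 1 := fun σ => by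
    have h := hH.deg_mem_Icc_of_graded e hF hFc σ
    rw [hn] at h
    omega
  obtain ⟨α, hα, hEF, hFE⟩ := exists_projE_mul_projF_eq_smul H ψ hn e hF hFc hdeg hX hXE h3
  set P := gradingEnd e deg with hP
  set Y := X.baseChange ℂ with hY
  set E := P * Y * (1 - P) with hEdef
  set F := (1 - P) * Y * P with hFdef
  have hPP : P * P = P := gradingEnd_mul_gradingEnd_of_deg e hdeg
  have hPF : P * F = 0 := by
    rw [hFdef, mul_assoc (1 - P) Y P, ← mul_assoc P (1 - P) (Y * P), mul_sub, mul_one, hPP, sub_self, zero_mul]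
  have hPe : ∀ τ : {σ : S // deg σ = 1}, P (e τ) = e τ := fun τ => by
    rw [hP, gradingEnd_apply_basis, τ.2, Int.cast_one, one_smul]
  -- the family
  let f : {σ : S // deg σ = 1} × Fin 2 → ℂ ⊗[ℚ] V := fun x => if x.2 = 0 then e x.1 else F (e x.1)
  have hf0 : ∀ τ, f (τ, 0) = e τ := fun τ => if_pos rfl
  have hf1 : ∀ τ, f (τ, 1) = F (e τ) := fun τ => if_neg (show ¬ ((1 : Fin 2) = 0) by decide)
  -- linear independence
  have hli : LinearIndependent ℂ f := by
    rw [Fintype.linearIndependent_iff]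
    intro g hg
    have hsum : ∑ τ, (g (τ, 0) • e τ + g (τ, 1) • F (e τ)) = 0 := by
      rw [← hg, Fintype.sum_prod_type]
      refine Finset.sum_congr rfl fun τ _ => ?_
      rw [Fin.sum_univ_two, hf0, hf1]
    have hsub : LinearIndependent ℂ fun τ : {σ : S // deg σ = 1} => e τ :=
      e.linearIndependent.comp _ Subtype.val_injective
    -- apply `P`: the `F`-terms die
    have hP0 : ∑ τ, g (τ, 0) • e (τ : S) = 0 := by
      have h := congrArg P hsum
      rw [map_sum, map_zero] at h
      rw [← h]
      refine Finset.sum_congr rfl fun τ _ => ?_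
      rw [map_add, map_smul, map_smul, hPe, ← Module.End.mul_apply, hPF, LinearMap.zero_apply, smul_zero,
        add_zero]
    have hg0 : ∀ τ, g (τ, 0) = 0 := Fintype.linearIndependent_iff.1 hsub _ hP0
    -- apply `E`: `E F e_τ = α e_τ`
    have hE1 : ∑ τ, (α * g (τ, 1)) • e (τ : S) = 0 := by
      have h := congrArg E hsum
      rw [map_sum, map_zero] at h
      rw [← h]
      refine Finset.sum_congr rfl fun τ _ => ?_
      rw [hg0, zero_smul, zero_add, map_smul, ← Module.End.mul_apply, hEF, LinearMap.smul_apply, hPe, smul_smul,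
        mul_comm]
    have hg1 : ∀ τ, g (τ, 1) = 0 := fun τ => by
      have h := Fintype.linearIndependent_iff.1 hsub _ hE1 τ
      exact (mul_eq_zero.1 h).resolve_left hα
    rintro ⟨τ, r⟩
    rcases Fin.eq_zero_or_eq_succ r with h0 | ⟨j, hj⟩
    · rw [h0]; exact hg0 τ
    · rw [hj, Fin.eq_zero j]; exact hg1 τ
  -- generation
  have hsp : ⊤ ≤ Submodule.span ℂ (Set.range f) := by
    intro v _
    have h1 : P v ∈ Submodule.span ℂ (Set.range f) := by
      have h := gradingEnd_apply_mem_span_one e hdeg v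
      refine (Submodule.span_le.2 ?_) h
      rintro _ ⟨σ, hσ, rfl⟩
      exact Submodule.subset_span ⟨(⟨σ, hσ⟩, 0), hf0 _⟩
    have h2 : (1 - P) v ∈ Submodule.span ℂ (Set.range f) := by
      have hv : (1 - P) v = α⁻¹ • F (E v) := by
        rw [← Module.End.mul_apply, hFE, LinearMap.smul_apply, smul_smul, inv_mul_cancel₀ hα, one_smul]
      rw [hv]
      refine Submodule.smul_mem _ _ ?_
      have hEv : E v ∈ Submodule.span ℂ (e '' {σ | deg σ = 1}) := by
        rw [hEdef, Module.End.mul_apply, Module.End.mul_apply]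
        exact gradingEnd_apply_mem_span_one e hdeg _
      have hle : (Submodule.span ℂ (e '' {σ | deg σ = 1})).map F ≤ Submodule.span ℂ (Set.range f) := by
        rw [Submodule.map_span_le]
        rintro _ ⟨σ, hσ, rfl⟩
        exact Submodule.subset_span ⟨(⟨σ, hσ⟩, 1), hf1 _⟩
      exact hle (Submodule.mem_map_of_mem hEv)
    have hv : v = P v + (1 - P) v := by
      rw [LinearMap.sub_apply, Module.End.one_apply, add_sub_cancel]
    rw [hv]
    exact Submodule.add_mem _ h1 h2
  refine ⟨Module.Basis.mk hli hsp, fun τ => ?_, fun τ => ?_⟩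
  · rw [Module.Basis.mk_apply, hf0]
  · rw [Module.Basis.mk_apply, hf1]


/-- **The triple acts on the pair basis by `2 × 2` blocks**: with `b (τ, 0) = u_τ = e τ`, `b (τ, 1) = w_τ = F u_τ` one has
`E u_τ = 0`, `E w_τ = α u_τ` (block `α E₀₁`), `F u_τ = w_τ`, `F w_τ = 0` (block `E₁₀`), `Θ′ u_τ = u_τ`, `Θ′ w_τ = −w_τ`
(block `diag(1, −1)`): `H ⊗ ℂ ≅ H^{1,0} ⊗ std` as a module over `ℂΘ′ ⊕ ℂE ⊕ ℂF ≅ 𝔰𝔩₂`.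
[cite: MoonenZarhin1999LowDim, §2] [cite: FultonHarris1991, Lecture 11 (§11.1)] -/
theorem HodgeStructure.pairBasis_actions (H : HodgeStructure V n) (ψ : H.Polarization) (hn : n = 1)
    (hH : H.IsEffective) (e : Module.Basis S ℂ (ℂ ⊗[ℚ] V))
    (hF : ∀ a, H.F a = Submodule.span ℂ (e '' {σ | a ≤ deg σ}))
    (hFc : ∀ a, complexConj (H.F a) = Submodule.span ℂ (e '' {σ | deg σ ≤ n - a}))
    {X : Module.End ℚ V} (hX : X ∈ H.hodgeLie) (hXE : X ∉ H.endAlg) (h3 : Module.finrank ℚ H.hodgeLie ≤ 3)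
    (b : Module.Basis ({σ : S // deg σ = 1} × Fin 2) ℂ (ℂ ⊗[ℚ] V)) (hb0 : ∀ τ, b (τ, 0) = e τ)
    (hb1 : ∀ τ, b (τ, 1) = ((1 - gradingEnd e deg) * X.baseChange ℂ * gradingEnd e deg) (e τ)) :
    ∃ α : ℂ, α ≠ 0 ∧
      (∀ τ r, (gradingEnd e deg * X.baseChange ℂ * (1 - gradingEnd e deg)) (b (τ, r)) =
        ∑ r', (α • Matrix.single 0 1 (1 : ℂ)) r' r • b (τ, r')) ∧
      (∀ τ r, ((1 - gradingEnd e deg) * X.baseChange ℂ * gradingEnd e deg) (b (τ, r)) =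
        ∑ r', (Matrix.single 1 0 (1 : ℂ) : Matrix (Fin 2) (Fin 2) ℂ) r' r • b (τ, r')) ∧
      (∀ τ r, ((2 : ℂ) • gradingEnd e deg - 1) (b (τ, r)) =
        ∑ r', (Matrix.diagonal ![(1 : ℂ), -1]) r' r • b (τ, r')) := by
  classical
  have hdeg : ∀ σ, deg σ = 0 ∨ deg σ = 1 := fun σ => by
    have h := hH.deg_mem_Icc_of_graded e hF hFc σ
    rw [hn] at h
    omega
  obtain ⟨α, hα, hEF, hFE⟩ := exists_projE_mul_projF_eq_smul H ψ hn e hF hFc hdeg hX hXE h3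
  set P := gradingEnd e deg with hP
  set Y := X.baseChange ℂ with hY
  set E := P * Y * (1 - P) with hEdef
  set F := (1 - P) * Y * P with hFdef
  have hPP : P * P = P := gradingEnd_mul_gradingEnd_of_deg e hdeg
  have hPE : P * E = E := by rw [hEdef, ← mul_assoc, ← mul_assoc, hPP]
  have hEP : E * P = 0 := by rw [hEdef, mul_assoc (P * Y) (1 - P) P, sub_mul, one_mul, hPP, sub_self, mul_zero]
  have hPF : P * F = 0 := by
    rw [hFdef, mul_assoc (1 - P) Y P, ← mul_assoc P (1 - P) (Y * P), mul_sub, mul_one, hPP, sub_self, zero_mul]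
  have hFP : F * P = F := by rw [hFdef, mul_assoc ((1 - P) * Y) P P, hPP]
  have hFF : F * F = 0 := (SL2Triple.mul_self_eq_zero hPE hEP hPF hFP).2
  have hPe : ∀ τ : {σ : S // deg σ = 1}, P (e τ) = e τ := fun τ => by
    rw [hP, gradingEnd_apply_basis, τ.2, Int.cast_one, one_smul]
  have hr1 : ∀ r : Fin 2, r ≠ 0 → r = 1 := fun r hr => by
    rcases Fin.eq_zero_or_eq_succ r with h0 | ⟨k, hk⟩
    · exact absurd h0 hr
    · rw [hk, Fin.eq_zero k]; rfl
  refine ⟨α, hα, fun τ r => ?_, fun τ r => ?_, fun τ r => ?_⟩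
  · rw [Fin.sum_univ_two, hb0]
    by_cases h0 : r = 0
    · rw [h0, hb0, ← hPe τ, ← Module.End.mul_apply, hEP, LinearMap.zero_apply]
      simp [Matrix.single]
    · rw [hr1 r h0, hb1, ← Module.End.mul_apply, hEF, LinearMap.smul_apply, hPe]
      simp [Matrix.single]
  · rw [Fin.sum_univ_two, hb0, hb1]
    by_cases h0 : r = 0
    · rw [h0, hb0]
      simp [Matrix.single]
    · rw [hr1 r h0, hb1, ← Module.End.mul_apply, hFF, LinearMap.zero_apply]
      simp [Matrix.single]
  · rw [Fin.sum_univ_two, hb0, hb1, LinearMap.sub_apply, LinearMap.smul_apply, Module.End.one_apply]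
    by_cases h0 : r = 0
    · rw [h0, hb0, hPe]
      simp [Matrix.diagonal, two_smul]
    · rw [hr1 r h0, hb1, ← Module.End.mul_apply, hPF, LinearMap.zero_apply, smul_zero, zero_sub]
      simp [Matrix.diagonal]

end PairBasis


end Literature.AlgebraicGeometry.HodgeTheory

end
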